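import Literature.MathematicalPhysics.QuantumFieldTheory.Balaban1983to89.WilsonLoopProductsNotDenseEvenOrthogonal
import Literature.LinearAlgebra.Matrix.SimultaneousConjugacyProducts
import HarnessLib

/-!
# CENSUS NEGATIVE FOR EVERY `SO(2m)`, `m ≥ 3`: word-wise conjugacy does NOT imply simultaneous conjugacy — two COMMUTING
# rotations already fail; trace words in EVERY representation do not separate orbits ([Weidner2020] Prop. 4.5;
# [Larsen1994] Prop. 3.8 / Thm 3.12 «SO(2n,ℝ), n ≥ 4»; `SO(6)`: [Yu2021] Example 4.1)

statement-level skeleton of published theorems with citation tags; proofs where landed; nothing here is a claim about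
the Yang–Mills mass gap

Cell `lit-balaban`, unit p24 gen 21 (own-lane free target of the Lie ∕ linear-algebra lineage, G.5-34(d); no SKELETON
row).  The lineage's orbit-separation census for module XXI's schema `TraceWordsSeparateOrbits ρ`: TRUE for `U(N)`, `SU(N)`
(p331019), `O(N)`, `SO(2m+1)` (p336810), `Sp(n)` (p339951); FALSE for the NATURAL representation of `SO(2m)`, `m ≥ 1`
(p340120); FALSE for ALL representations of `SO(8)` (p352070, via `Ad : U(3) → SO(8)`, a finite sub-family found by
compactness).  THIS FILE settles every even `N ≥ 6` at once, with an EXPLICIT pair of two-letter families generating a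
quotient of `ℤ/4 × ℤ/4`, following M. Weidner's finite abelian counterexample:

[Weidner2020] §4.3, Prop. 4.5: «Let `Γ = ℤ/4ℤ × ℤ/4ℤ` … `A = (0 1; −1 0) ∈ SO₂` … For any
`n ≥ 3`, the homomorphism `ρ_{2n} : Γ → SO_{2n}` defined by `ρ_{2n}(1,0) = A ⊕ A ⊕ I ⊕ ⨁_{i=4}^n A`,
`ρ_{2n}(0,1) = I ⊕ A ⊕ A ⊕ ⨁_{i=4}^n A` satisfies `det(ρ_{2n}(γ) − ρ_{2n}(γ)ᵗ) = 0` for all `γ ∈ Γ` and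
`pl(ρ_{2n}(1,0), ρ_{2n}(0,1), …, ρ_{2n}(0,1)) ≠ 0`.  Hence `ρ_{2n}` gives a counterexample to element-conjugacy implying
global conjugacy» (proof: «for all `γ ∈ Γ`, one of the first three `2 × 2` diagonal blocks is a symmetric matrix»).  The
range `SO(2n, ℝ)`, `n ≥ 4`, is M. Larsen's [Larsen1994] Prop. 3.8 / Thm 3.12 (with the Steinberg representation of
`SL(3, 𝔽₂)` padded by quarter turns, and the argument «all real matrices commuting with `φ₁(Γ)` have positive
determinant … for any `α ∈ Γ`, `φ₁(α)` fixes some vector `v_α`. Let `N_α` denote the reflection through `v_α^⊥`. Then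
`N_α M⁻¹ ∈ SO(n, ℝ)`»); `SO(6)` is [Yu2021] Example 4.1 (`SU(4)/⟨−I⟩ ≅ SO(6)`, `Γ = (C₄)²`, «first shown by Matthew
Weidner»).  POSITIVE EVEN CELL IN PRINT, NOT FORMALISED HERE: `SO(4)` IS acceptable ([Yu2021] Thm 1.1 / Thm 4.1 (3), via
`G₂^θ ≅ Sp(1)²/⟨(−1,−1)⟩`); `SO(2)` is abelian.  So with this file the lineage's census of `TraceWordsSeparateOrbits` over
ALL representations reads: fails for `SO(2m)` iff `m ≥ 3` among `m ≥ 1` granted print for `m = 2`.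

WHAT IS PROVED (kernel; `m : ℕ`, planes `k < m` of `ℝ^{2m}` spanned by the coordinates `castAdd k`, `natAdd k` of
`Fin (m+m)` — the frame of the lineage's `realJ m`):
* §1 the commutative algebra of PLANE ROTATION–DILATIONS `rot c s = (diag c, −diag s; diag s, diag c)` and the ring
  homomorphism `Φ : (Fin m → ℂ) →+* M_{2m}(ℝ)`, `Φ u = rot (Re u) (Im u)` (`Φ(ū) = Φ(u)ᵀ`, `Φ(i) = realJ m`, `Φ u`
  orthogonal for unimodular `u`); the coordinate reflection `N_P` of the plane `P` (`det N_P = −1`) COMMUTES with `Φ u`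
  as soon as `Im u_P = 0` (`negPlane_mul_Φ_comm`) — Weidner's «symmetric `2 × 2` block», Larsen's fixed vector `v_α`;
* §2 Weidner's generators `D₁ = Φ(i,i,1,i,…)`, `D₂ = Φ(1,i,i,i,…)` in `SO(2m)` (`genV`), commuting, of order `4`; the
  twisted family `genW i₀ = P_{i₀} · genV · P_{i₀}` (`reflConj`, p348765) for ANY coordinate reflection `P_{i₀}`;
  every element of the subgroup generated by `D₁, D₂` is `Φ(u₁^a u₂^b)` and has a plane among `0, 1, 2` with real
  diagonal value (`a`, `b` or `a + b` is even), HENCE IS CONJUGATE IN `SO(2m)` TO ITS `P_{i₀}`-TWIST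
  (`exists_conj_of_mem_closure`, conjugator `P_{i₀} N_P`); in particular every word and every positive product is;
* §3 NO SIMULTANEOUS CONJUGATOR (`not_exists_simultaneous_conj`, every `m`): `2J = D₁(1 − D₁²) + D₂(1 + D₁²)` with
  `J = realJ m`, so a conjugator `g ∈ SO(2m)` would give `g J gᵀ = P_{i₀} J P_{i₀}`, and the Pfaffian of the skew part
  (p340120's `pfaffianSkew_conj`, [AslaksenTanZhu1995]) changes sign: `p̃f(J) = det g · p̃f(J) = det P_{i₀} · p̃f(J) = −p̃f(J)`,
  `p̃f(J) ≠ 0` — this replaces Weidner's polarized Pfaffian `pl` and Larsen's positive-determinant commutant;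
* §4 consequences for `m ≥ 3` (and for `SO(N)`, `N` even, `N ≥ 6`): **`¬ ProdConjDetermined SO(2m)`** ([Sengupta1994]
  Thm 2's conclusion fails; p334319's property), **`¬ TraceWordsSeparateOrbits ρ` for EVERY `ρ : SO(2m) →* M_K(ℂ)`**
  (module XXI's schema fails in all representations at once), and the shape of [Levy2004] Prop. 3.4 fails with `r = 2`
  letters (`exists_wordwise_conj_not_simultaneous_conj`): the `SO(n)` clause of [Levy2004] Thm 3.1 / Prop. 3.4 fails for
  every even `n ≥ 6` (HOME/GAPS.md G-p24-g20-1 extended), in agreement with [Larsen1994] Thm 3.12 and [Yu2021] Thm 1.1.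

HONEST SCOPE.  (a) `SO(4)` (acceptable in print, [Yu2021]) and the trivial `SO(2)` are NOT treated; nothing here proves a
positive statement.  (b) Real compact `SO(2m)` only (Weidner and Larsen print `SO_{2n}(ℂ)` / `SO(2n, ℂ)` as well; same
matrices, not formalised).  (c) Nothing about torus states or the infinite-volume question; the lattice form (density of
loop observables on `ℤ^d`) is the companion file `ClassLoopObservablesNotDenseEvenOrthogonal`.  NOT summit progress.

## References

* [Weidner2020] M. Weidner, *Pseudocharacters of homomorphisms into classical groups*, Transform. Groups 25 (2020)
  1345–1370 (arXiv:1809.03644, whose numbering is used): §4.3 «A finite abelian counterexample for SO(2n), n ≥ 3» and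
  Prop. 4.5 (the pair above), Prop. 4.4 (criterion for `SO_{2n}`: «ρ' = XρX⁻¹», `X ∈ O_{2n} ∖ SO_{2n}`).
* [Larsen1994] M. Larsen, *On the conjugacy of element-conjugate homomorphisms*, Israel J. Math. 88 (1994) 253–277:
  Prop. 3.8 pp. 270–271 («For all even `n ≥ 8`, `SL(n,ℝ)`, `SO(n,ℝ)`, and `SO(n,ℂ)` are unacceptable»), Thm 3.12 p. 276
  («`SO(2n, ℝ)`, `n ≥ 4`»), Cor. 2.5 p. 262 (`SU(n)`, `SO(2n+1,ℝ)`, `Sp(n)` acceptable).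
* [Yu2021] J. Yu, *Acceptable compact Lie groups*, Peking Math. J. 5 (2021) 427–446 (arXiv:1806.06316, whose numbering
  is used): Thm 1.1 (classification: `SU(n)`, `Sp(n)`, `SO(2n+1)`, `G₂`, `SO(4)`), Thm 4.1 (3) (`SO(4)` strongly
  acceptable), Example 4.1 (`SU(4)/⟨−I⟩ ≅ SO(6)` unacceptable; «the unacceptability of SO(6) is first shown by Matthew
  Weidner»).
* [AslaksenTanZhu1995] H. Aslaksen, E.-C. Tan, C.-B. Zhu, Pacific J. Math. 168 (1995) §1 p.207 (`p̃f`, `pf(gAgᵗ) = det g pf A`).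
* [Sengupta1994] A. Sengupta, Proc. AMS 121 (1994) Thm 2 p.900; [Levy2004] T. Lévy, J. Geom. Phys. 52 (2004) Prop. 3.4,
  Thm 3.1 (the `SO(n)` clause), Prop. 3.6.
-/

noncomputable section

open Matrix
open scoped Matrix ComplexConjugate

namespace Literature.MathematicalPhysics.QuantumFieldTheory.Balaban1983to89.WilsonLoopsNotCompleteEvenOrthogonal

open Literature.LinearAlgebra.Matrix (ProdConjDetermined prodConjDetermined_iff pfaffian)
open Balaban1983to89.Missing (TraceWordsSeparateOrbits)
open TraceWordsSeparateOrbitsOrthogonal (specialOrthogonalRep)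
open TraceWordsSeparateOrbitsEvenOrthogonal (realJ negAt pfaffianSkew_conj pfaffianSkew_realJ_ne_zero star_negAt det_negAt
  negAt_mul_negAt negAt_mem_orthogonalGroup realJ_mem_specialOrthogonalGroup)
open WilsonLoopProductsNotDenseEvenOrthogonal (reflConj coe_reflConj)

universe v

/-- `SO(2m)` as a type: Mathlib's `Matrix.specialOrthogonalGroup (Fin (m + m)) ℝ`. [folklore] -/
abbrev SO2 (m : ℕ) : Type := Matrix.specialOrthogonalGroup (Fin (m + m)) ℝ

variable (m : ℕ)

/-! ## §1 Plane rotation–dilations, the homomorphism `Φ`, and the coordinate reflections of the planes -/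

section Planes

/-- For a real matrix `star = transpose`. [folklore] -/
private theorem star_eq_transpose' {n : Type*} [Fintype n] (A : Matrix n n ℝ) : star A = Aᵀ := by
  rw [Matrix.star_eq_conjTranspose, Matrix.conjTranspose_eq_transpose_of_trivial]

/-- **PLANE ROTATION–DILATIONS**: `rot c s` acts on the plane `k` (coordinates `castAdd k`, `natAdd k`) by the matrix
`(c_k, −s_k; s_k, c_k)` — Weidner's blocks `A = (0 1; −1 0)`, `I`, up to orientation, assembled as
`(diag c, −diag s; diag s, diag c)` on `Fin m ⊕ Fin m` and re-indexed to `Fin (m + m)` (the frame of `realJ m`).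
[cite: Weidner2020, §4.3 (ρ_{2n} = direct sum of 2×2 blocks A, I)] -/
def rot (c s : Fin m → ℝ) : Matrix (Fin (m + m)) (Fin (m + m)) ℝ :=
  Matrix.reindexAlgEquiv ℝ ℝ finSumFinEquiv
    (Matrix.fromBlocks (Matrix.diagonal c) (Matrix.diagonal (-s)) (Matrix.diagonal s) (Matrix.diagonal c))

/-- `diagonal (−f) = −diagonal f`. [folklore] -/
private theorem diagonal_neg' {n : Type*} [DecidableEq n] (f : n → ℝ) : Matrix.diagonal (-f) = -Matrix.diagonal f := by
  rw [Matrix.diagonal_neg]; rfl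

/-- Products: complex multiplication plane by plane. [cite: Weidner2020, §4.3 (block-diagonal computation in the proof of Prop. 4.5)] -/
theorem rot_mul (c s c' s' : Fin m → ℝ) :
    rot m c s * rot m c' s' = rot m (c * c' - s * s') (c * s' + s * c') := by
  rw [rot, rot, rot, ← map_mul, Matrix.fromBlocks_multiply]
  congr 1
  simp only [Matrix.diagonal_mul_diagonal, Matrix.diagonal_add]
  refine Matrix.fromBlocks_inj.2 ⟨?_, ?_, ?_, ?_⟩
  all_goals
    congr 1
    funext i
    simp only [Pi.mul_apply, Pi.sub_apply, Pi.add_apply, Pi.neg_apply]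
    ring

/-- Sums. [folklore] -/
private theorem rot_add (c s c' s' : Fin m → ℝ) : rot m c s + rot m c' s' = rot m (c + c') (s + s') := by
  rw [rot, rot, rot, ← map_add, Matrix.fromBlocks_add]
  congr 1
  simp only [Matrix.diagonal_add]
  refine Matrix.fromBlocks_inj.2 ⟨rfl, ?_, rfl, rfl⟩
  congr 1; funext i; simp only [Pi.neg_apply, Pi.add_apply]; ring

/-- `rot 1 0 = 1`. [folklore] -/
private theorem rot_one : rot m (fun _ => 1) (fun _ => 0) = 1 := by
  rw [rot, diagonal_neg', Matrix.diagonal_one, Matrix.diagonal_zero, neg_zero, Matrix.fromBlocks_one, map_one]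

/-- `rot 0 0 = 0`. [folklore] -/
private theorem rot_zero : rot m (fun _ => 0) (fun _ => 0) = 0 := by
  rw [rot, diagonal_neg', Matrix.diagonal_zero, neg_zero, Matrix.fromBlocks_zero, map_zero]

/-- Transpose = complex conjugation plane by plane. [folklore] -/
private theorem rot_transpose (c s : Fin m → ℝ) : (rot m c s)ᵀ = rot m c (-s) := by
  rw [rot, rot, Matrix.coe_reindexAlgEquiv, Matrix.transpose_reindex, Matrix.fromBlocks_transpose,
    Matrix.diagonal_transpose, Matrix.diagonal_transpose, Matrix.diagonal_transpose, neg_neg]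

/-- **THE HOMOMORPHISM `Φ : (Fin m → ℂ) →+* M_{2m}(ℝ)`**, `Φ u = rot (Re u) (Im u)`: the plane `k` carries the real
`2 × 2` matrix of multiplication by `u_k`. [cite: Weidner2020, §4.3 (A ∈ SO₂, blocks of ρ_{2n})] -/
def Φ : (Fin m → ℂ) →+* Matrix (Fin (m + m)) (Fin (m + m)) ℝ where
  toFun u := rot m (fun k => (u k).re) (fun k => (u k).im)
  map_one' := by
    simp only [Pi.one_apply, Complex.one_re, Complex.one_im]
    exact rot_one m
  map_mul' u v := by
    rw [rot_mul]
    rfl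
  map_zero' := by
    simp only [Pi.zero_apply, Complex.zero_re, Complex.zero_im]
    exact rot_zero m
  map_add' u v := by
    rw [rot_add]
    rfl

/-- Unfolding. [folklore] -/
private theorem Φ_apply (u : Fin m → ℂ) : Φ m u = rot m (fun k => (u k).re) (fun k => (u k).im) := rfl

/-- `Φ(ū) = Φ(u)ᵀ`. [folklore] -/
private theorem Φ_star (u : Fin m → ℂ) : Φ m (star u) = (Φ m u)ᵀ := by
  rw [Φ_apply, Φ_apply, rot_transpose]
  rfl

/-- **`Φ(i, …, i) = realJ m`** — the lineage's quarter turn in every plane (p340120). [cite: AslaksenTanZhu1995, §1 Lemma 1 (proof) p.208] -/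
theorem Φ_I : Φ m (fun _ => Complex.I) = realJ m := by
  rw [Φ_apply, rot, realJ, Matrix.coe_reindexAlgEquiv, Matrix.J, diagonal_neg']
  simp only [Complex.I_re, Complex.I_im, Matrix.diagonal_zero, Matrix.diagonal_one]

/-- `Φ u` is ORTHOGONAL when `u` is unimodular (`ū u = 1`). [cite: Weidner2020, §4.3 (A ∈ SO₂)] -/
theorem Φ_mem_orthogonalGroup {u : Fin m → ℂ} (hu : star u * u = 1) :
    Φ m u ∈ Matrix.orthogonalGroup (Fin (m + m)) ℝ := by
  rw [Matrix.mem_unitaryGroup_iff', star_eq_transpose', ← Φ_star, ← map_mul, hu, map_one]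

/-- `det Φ(v²) = 1` for unimodular `v` (`det Φ(v) = ±1`). [folklore] -/
private theorem det_Φ_mul_self {v : Fin m → ℂ} (hv : star v * v = 1) : (Φ m (v * v)).det = 1 := by
  have h : (Φ m v)ᵀ * Φ m v = 1 := by rw [← Φ_star, ← map_mul, hv, map_one]
  have h' := congrArg Matrix.det h
  rw [Matrix.det_mul, Matrix.det_transpose, Matrix.det_one] at h'
  rw [map_mul, Matrix.det_mul, h']

/-- `Φ(v²) ∈ SO(2m)` for unimodular `v`. [cite: Weidner2020, §4.3 (ρ_{2n} lands in SO_{2n})] -/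
theorem Φ_mul_self_mem {v : Fin m → ℂ} (hv : star v * v = 1) :
    Φ m (v * v) ∈ Matrix.specialOrthogonalGroup (Fin (m + m)) ℝ := by
  refine Matrix.mem_specialOrthogonalGroup_iff.2 ⟨Φ_mem_orthogonalGroup m ?_, det_Φ_mul_self m hv⟩
  rw [star_mul, mul_mul_mul_comm, hv, one_mul]

/-- **THE COORDINATE REFLECTION OF THE PLANE `P`**: `N_P = diag(1, …, −1, …, 1)` with `−1` at the coordinate `castAdd P`
(Larsen's reflection `N_α` through `v_α^⊥`, `v_α` a fixed vector; an element of `O(2m) ∖ SO(2m)`).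
[cite: Larsen1994, Prop 3.8 (proof, p.271: «Let N_α denote the reflection through v_α^⊥»)] -/
def negPlane (P : Fin m) : Matrix (Fin (m + m)) (Fin (m + m)) ℝ :=
  Matrix.reindexAlgEquiv ℝ ℝ finSumFinEquiv
    (Matrix.fromBlocks (Matrix.diagonal (Function.update (fun _ => (1 : ℝ)) P (-1))) 0 0 1)

variable {m}

/-- The diagonal of `N_P` squares to one. [folklore] -/
private theorem update_mul_self (P i : Fin m) :
    Function.update (fun _ => (1 : ℝ)) P (-1) i * Function.update (fun _ => (1 : ℝ)) P (-1) i = 1 := by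
  rcases eq_or_ne i P with rfl | h
  · simp
  · simp [Function.update_of_ne h]

/-- `N_P² = 1`. [folklore] -/
private theorem negPlane_mul_self (P : Fin m) : negPlane m P * negPlane m P = 1 := by
  rw [negPlane, ← map_mul, Matrix.fromBlocks_multiply]
  simp only [Matrix.diagonal_mul_diagonal, Matrix.mul_zero, Matrix.zero_mul, add_zero, zero_add, Matrix.mul_one,
    update_mul_self, Matrix.diagonal_one, Matrix.fromBlocks_one, map_one]

/-- `N_Pᵀ = N_P`. [folklore] -/
private theorem transpose_negPlane (P : Fin m) : (negPlane m P)ᵀ = negPlane m P := by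
  rw [negPlane, Matrix.coe_reindexAlgEquiv, Matrix.transpose_reindex, Matrix.fromBlocks_transpose,
    Matrix.diagonal_transpose, Matrix.transpose_zero, Matrix.transpose_one]

/-- `N_P ∈ O(2m)`. [cite: Larsen1994, Prop 3.8 (proof p.271)] -/
theorem negPlane_mem_orthogonalGroup (P : Fin m) : negPlane m P ∈ Matrix.orthogonalGroup (Fin (m + m)) ℝ := by
  rw [Matrix.mem_unitaryGroup_iff', star_eq_transpose', transpose_negPlane, negPlane_mul_self]

/-- `det N_P = −1`. [cite: Larsen1994, Prop 3.8 (proof p.271: N_α M⁻¹ ∈ SO(n,ℝ))] -/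
theorem det_negPlane (P : Fin m) : (negPlane m P).det = -1 := by
  rw [negPlane, Matrix.det_reindexAlgEquiv, Matrix.det_fromBlocks_zero₂₁, Matrix.det_one, mul_one, Matrix.det_diagonal,
    Finset.prod_update_of_mem (Finset.mem_univ P)]
  simp

/-- **`N_P` COMMUTES WITH `Φ u` WHEN THE PLANE `P` IS REAL** (`Im u_P = 0`: the block is `±I`, «a symmetric matrix»;
equivalently `Φ u` fixes or negates the vector `e_{castAdd P}`). [cite: Weidner2020, Prop 4.5 (proof: «one of the first three 2 × 2 diagonal blocks is a symmetric matrix»); Larsen1994, Prop 3.8 (proof p.271)] -/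
theorem negPlane_mul_rot_comm (P : Fin m) {c s : Fin m → ℝ} (hs : s P = 0) :
    negPlane m P * rot m c s = rot m c s * negPlane m P := by
  rw [negPlane, rot, ← map_mul, ← map_mul, Matrix.fromBlocks_multiply, Matrix.fromBlocks_multiply]
  congr 1
  simp only [Matrix.diagonal_mul_diagonal, Matrix.mul_zero, Matrix.zero_mul, add_zero, zero_add, Matrix.mul_one,
    Matrix.one_mul]
  have key : ∀ i, Function.update (fun _ => (1 : ℝ)) P (-1) i * s i = s i := fun i => by
    rcases eq_or_ne i P with rfl | h
    · simp [hs]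
    · simp [Function.update_of_ne h]
  refine Matrix.fromBlocks_inj.2 ⟨?_, ?_, ?_, rfl⟩
  · congr 1; funext i; ring
  · congr 1; funext i; rw [Pi.neg_apply, mul_neg, key]
  · congr 1; funext i; rw [mul_comm, key]

/-- Matrix form for `Φ`: `N_P Φ(u) = Φ(u) N_P` if `Im u_P = 0`. [cite: Weidner2020, Prop 4.5 (proof)] -/
theorem negPlane_mul_Φ_comm (P : Fin m) {u : Fin m → ℂ} (hu : (u P).im = 0) :
    negPlane m P * Φ m u = Φ m u * negPlane m P :=
  negPlane_mul_rot_comm P (s := fun k => (u k).im) hu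

end Planes

/-! ## §2 Weidner's two commuting generators, the reflected family, and word-wise conjugacy -/

section Generators

/-- A primitive eighth root of unity `ζ = (1 + i)/√2` (so that the quarter turn `i = ζ²` is visibly a square in
`SO(2)`, which pins `det = +1`). [folklore] -/
def ζ : ℂ := ⟨Real.sqrt 2 / 2, Real.sqrt 2 / 2⟩

/-- `(√2/2)² + (√2/2)² = 1`. [folklore] -/
private theorem sqrt_two_half_sq : Real.sqrt 2 / 2 * (Real.sqrt 2 / 2) = 1 / 2 := by
  have h : Real.sqrt 2 * Real.sqrt 2 = 2 := Real.mul_self_sqrt (by norm_num)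
  linear_combination (1 / 4 : ℝ) * h

/-- `ζ² = i`. [folklore] -/
private theorem ζ_mul_ζ : ζ * ζ = Complex.I := by
  refine Complex.ext ?_ ?_
  · rw [Complex.mul_re]
    change Real.sqrt 2 / 2 * (Real.sqrt 2 / 2) - Real.sqrt 2 / 2 * (Real.sqrt 2 / 2) = 0
    ring
  · rw [Complex.mul_im]
    change Real.sqrt 2 / 2 * (Real.sqrt 2 / 2) + Real.sqrt 2 / 2 * (Real.sqrt 2 / 2) = 1
    rw [sqrt_two_half_sq]; norm_num

/-- `ζ̄ ζ = 1`. [folklore] -/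
private theorem conj_ζ_mul_ζ : conj ζ * ζ = 1 := by
  refine Complex.ext ?_ ?_
  · rw [Complex.mul_re, Complex.conj_re, Complex.conj_im]
    change Real.sqrt 2 / 2 * (Real.sqrt 2 / 2) - -(Real.sqrt 2 / 2) * (Real.sqrt 2 / 2) = 1
    rw [neg_mul, sub_neg_eq_add, sqrt_two_half_sq]; norm_num
  · rw [Complex.mul_im, Complex.conj_re, Complex.conj_im]
    change Real.sqrt 2 / 2 * (Real.sqrt 2 / 2) + -(Real.sqrt 2 / 2) * (Real.sqrt 2 / 2) = 0
    ring

/-- Square roots of Weidner's generators: `w 0 = (ζ, ζ, 1, ζ, …)`, `w 1 = (1, ζ, ζ, ζ, …)` (plane `2` resp. plane `0`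
inert). [cite: Weidner2020, §4.3 (ρ_{2n}(1,0) = A⊕A⊕I⊕A⊕⋯, ρ_{2n}(0,1) = I⊕A⊕A⊕A⊕⋯)] -/
def w (i : Fin 2) (k : Fin m) : ℂ := if (k : ℕ) = (if i = 0 then 2 else 0) then 1 else ζ

/-- **WEIDNER'S EXPONENT VECTORS** `u 0 = (i, i, 1, i, …)`, `u 1 = (1, i, i, i, …)`: `u i = (w i)²`.
[cite: Weidner2020, §4.3 and Prop 4.5] -/
def uGen (i : Fin 2) : Fin m → ℂ := w m i * w m i

/-- Normal form: `u i k = 1` on the inert plane of `i` (`2` for `i = 0`, `0` for `i = 1`), `= i` elsewhere.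
[cite: Weidner2020, §4.3] -/
theorem uGen_apply (i : Fin 2) (k : Fin m) :
    uGen m i k = if (k : ℕ) = (if i = 0 then 2 else 0) then 1 else Complex.I := by
  simp only [uGen, Pi.mul_apply, w]
  split_ifs <;> first | exact ζ_mul_ζ | simp

/-- `u₁ = (i, i, 1, i, …)`: plane `2` inert. [cite: Weidner2020, §4.3 (ρ_{2n}(1,0) = A⊕A⊕I⊕A⊕⋯)] -/
theorem uGen_zero_apply (k : Fin m) : uGen m 0 k = if (k : ℕ) = 2 then 1 else Complex.I := by
  rw [uGen_apply, if_pos (rfl : (0 : Fin 2) = 0)]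

/-- `u₂ = (1, i, i, i, …)`: plane `0` inert. [cite: Weidner2020, §4.3 (ρ_{2n}(0,1) = I⊕A⊕A⊕A⊕⋯)] -/
theorem uGen_one_apply (k : Fin m) : uGen m 1 k = if (k : ℕ) = 0 then 1 else Complex.I := by
  rw [uGen_apply, if_neg (show (1 : Fin 2) ≠ 0 by decide)]

/-- `w i` is unimodular. [folklore] -/
private theorem star_w_mul_w (i : Fin 2) : star (w m i) * w m i = 1 := by
  funext k
  simp only [Pi.mul_apply, Pi.star_apply, Pi.one_apply, w]
  split_ifs <;> first | exact conj_ζ_mul_ζ | simp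

/-- `ū i = (u i)³` (the values are `1` and `i`). [folklore] -/
private theorem star_uGen (i : Fin 2) : star (uGen m i) = uGen m i ^ 3 := by
  funext k
  rw [Pi.star_apply, Pi.pow_apply, uGen_apply]
  split_ifs <;> simp

/-- `(u i)⁴ = 1`. [cite: Weidner2020, §4.3 (Γ = ℤ/4ℤ × ℤ/4ℤ)] -/
theorem uGen_pow_four (i : Fin 2) : uGen m i ^ 4 = 1 := by
  funext k
  rw [Pi.pow_apply, Pi.one_apply, uGen_apply]
  split_ifs <;> simp

/-- **WEIDNER'S GENERATORS `D₁ = genV 0`, `D₂ = genV 1` IN `SO(2m)`** — quarter turns in the planes `{0, 1} ∪ {3, …}` resp.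
`{1, 2} ∪ {3, …}`, identity in the plane `2` resp. `0` (his `ρ_{2n}(1,0)`, `ρ_{2n}(0,1)`, up to the orientation of `A`).
[cite: Weidner2020, §4.3 and Prop 4.5] -/
def genV (i : Fin 2) : SO2 m := ⟨Φ m (uGen m i), Φ_mul_self_mem m (star_w_mul_w m i)⟩

/-- Matrix of `genV i`. [cite: Weidner2020, §4.3] -/
@[simp] theorem coe_genV (i : Fin 2) : ((genV m i : SO2 m) : Matrix (Fin (m + m)) (Fin (m + m)) ℝ) = Φ m (uGen m i) := rfl

/-- **The generators COMMUTE** (the image of `Γ = ℤ/4 × ℤ/4` is abelian). [cite: Weidner2020, §4.3 (Γ = ℤ/4ℤ × ℤ/4ℤ, «A Finite Abelian Counterexample»)] -/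
theorem genV_comm : genV m 0 * genV m 1 = genV m 1 * genV m 0 :=
  Subtype.ext (by simp only [Submonoid.coe_mul, coe_genV, ← map_mul, mul_comm])

/-- **… and have order dividing `4`.** [cite: Weidner2020, §4.3 (Γ = ℤ/4ℤ × ℤ/4ℤ)] -/
theorem genV_pow_four (i : Fin 2) : genV m i ^ 4 = 1 :=
  Subtype.ext (by simp only [SubmonoidClass.coe_pow, coe_genV, ← map_pow, uGen_pow_four, map_one, OneMemClass.coe_one])

/-- **THE TWISTED FAMILY `genW i₀ = P_{i₀} · genV · P_{i₀}`** — conjugate by the coordinate reflection `P_{i₀} ∈ O(2m) ∖ SO(2m)`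
(Weidner's `ρ' = XρX⁻¹`, `X ∈ O_{2n} ∖ SO_{2n}`; the lineage's `reflConj`, p348765). [cite: Weidner2020, Prop 4.4 («ρ' = XρX⁻¹»)] -/
def genW (i₀ : Fin (m + m)) (i : Fin 2) : SO2 m := reflConj m i₀ (genV m i)

/-- `genW = reflConj ∘ genV` (the twist `ρ' = XρX⁻¹` as a composition). [cite: Weidner2020, Prop 4.4 («ρ' = XρX⁻¹»)] -/
theorem genW_eq (i₀ : Fin (m + m)) : genW m i₀ = reflConj m i₀ ∘ genV m := rfl

variable {m}

/-- **EVERY ELEMENT OF THE SUBGROUP GENERATED BY `D₁, D₂` IS `Φ(u₁^a u₂^b)`** (`a, b ∈ ℕ`; inverses are cubes).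
[cite: Weidner2020, Prop 4.5 (proof: «write ρ(γ) = ⊕ B^{(i)}»)] -/
theorem exists_coe_eq_Φ_of_mem_closure {X : SO2 m} (hX : X ∈ Subgroup.closure (Set.range (genV m))) :
    ∃ a b : ℕ, (X : Matrix (Fin (m + m)) (Fin (m + m)) ℝ) = Φ m (uGen m 0 ^ a * uGen m 1 ^ b) := by
  induction hX using Subgroup.closure_induction with
  | mem x hx =>
    obtain ⟨i, rfl⟩ := hx
    fin_cases i
    · exact ⟨1, 0, by simp⟩
    · exact ⟨0, 1, by simp⟩
  | one => exact ⟨0, 0, by simp⟩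
  | mul x y _ _ hx hy =>
    obtain ⟨a, b, h⟩ := hx
    obtain ⟨a', b', h'⟩ := hy
    refine ⟨a + a', b + b', ?_⟩
    rw [Submonoid.coe_mul, h, h', ← map_mul]
    congr 1
    ring
  | inv x _ hx =>
    obtain ⟨a, b, h⟩ := hx
    refine ⟨3 * a, 3 * b, ?_⟩
    rw [← Matrix.star_eq_inv, Matrix.specialUnitaryGroup.coe_star, h, star_eq_transpose', ← Φ_star, star_mul, star_pow,
      star_pow, star_uGen, star_uGen, ← pow_mul, ← pow_mul]
    exact congrArg (Φ m) (mul_comm _ _)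

/-- `Im (i^n) = 0` for even `n`. [folklore] -/
private theorem im_I_pow_of_even {n : ℕ} (hn : Even n) : (Complex.I ^ n).im = 0 := by
  obtain ⟨k, rfl⟩ := hn
  rw [← two_mul, pow_mul, Complex.I_sq]
  rcases neg_one_pow_eq_or ℂ k with h | h <;> rw [h] <;> simp

/-- **ONE OF THE PLANES `0, 1, 2` IS REAL**: for every `a, b`, the value of `u₁^a u₂^b` on the plane `0` (`i^a`), `2` (`i^b`)
or `1` (`i^{a+b}`) is `±1` — one of `a`, `b`, `a + b` is even (Weidner: «for all `γ ∈ Γ`, one of the first three `2 × 2`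
diagonal blocks is a symmetric matrix»). [cite: Weidner2020, Prop 4.5 (proof)] -/
theorem exists_plane_im_eq_zero (hm : 3 ≤ m) (a b : ℕ) :
    ∃ P : Fin m, ((uGen m 0 ^ a * uGen m 1 ^ b) P).im = 0 := by
  rcases Nat.even_or_odd a with ha | ha
  · refine ⟨⟨0, by omega⟩, ?_⟩
    rw [Pi.mul_apply, Pi.pow_apply, Pi.pow_apply, uGen_zero_apply, uGen_one_apply, if_neg (by norm_num), if_pos rfl,
      one_pow, mul_one]
    exact im_I_pow_of_even ha
  rcases Nat.even_or_odd b with hb | hb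
  · refine ⟨⟨2, by omega⟩, ?_⟩
    rw [Pi.mul_apply, Pi.pow_apply, Pi.pow_apply, uGen_zero_apply, uGen_one_apply, if_pos rfl, if_neg (by norm_num),
      one_pow, one_mul]
    exact im_I_pow_of_even hb
  · refine ⟨⟨1, by omega⟩, ?_⟩
    rw [Pi.mul_apply, Pi.pow_apply, Pi.pow_apply, uGen_zero_apply, uGen_one_apply, if_neg (by norm_num),
      if_neg (by norm_num), ← pow_add]
    exact im_I_pow_of_even (Odd.add_odd ha hb)

/-- `P_{i₀} N_P ∈ SO(2m)` (`det = (−1)(−1)`; Larsen: «`N_α M⁻¹ ∈ SO(n, ℝ)`»). [cite: Larsen1994, Prop 3.8 (proof p.271)] -/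
theorem negAt_mul_negPlane_mem (i₀ : Fin (m + m)) (P : Fin m) :
    negAt i₀ * negPlane m P ∈ Matrix.specialOrthogonalGroup (Fin (m + m)) ℝ := by
  refine Matrix.mem_specialOrthogonalGroup_iff.2 ⟨Submonoid.mul_mem _ (negAt_mem_orthogonalGroup i₀)
    (negPlane_mem_orthogonalGroup P), ?_⟩
  rw [Matrix.det_mul, det_negAt, det_negPlane]; norm_num

variable (m)

/-- **EVERY ELEMENT OF `⟨D₁, D₂⟩` IS CONJUGATE IN `SO(2m)` TO ITS `P_{i₀}`-TWIST** (`m ≥ 3`, any coordinate reflection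
`P_{i₀}`): `P_{i₀} X P_{i₀} = y X y⁻¹` with `y = P_{i₀} N_P ∈ SO(2m)`, `P` a real plane of `X` (Weidner: element-conjugacy of
`ρ_{2n}` and `Xρ_{2n}X⁻¹`; Larsen: «`φ₂(α) = M N_α⁻¹ φ₁(α) N_α M⁻¹` is `SO(n, ℝ)`-conjugate to `φ₁(α)`»).
[cite: Weidner2020, Prop 4.5; Larsen1994, Prop 3.8 (proof p.271)] -/
theorem exists_conj_of_mem_closure (hm : 3 ≤ m) (i₀ : Fin (m + m)) {X : SO2 m}
    (hX : X ∈ Subgroup.closure (Set.range (genV m))) : ∃ y : SO2 m, reflConj m i₀ X = y * X * y⁻¹ := by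
  obtain ⟨a, b, hab⟩ := exists_coe_eq_Φ_of_mem_closure hX
  obtain ⟨P, hP⟩ := exists_plane_im_eq_zero hm a b
  have hcomm : negPlane m P * (X : Matrix (Fin (m + m)) (Fin (m + m)) ℝ) = X * negPlane m P := by
    rw [hab]; exact negPlane_mul_Φ_comm P hP
  refine ⟨⟨negAt i₀ * negPlane m P, negAt_mul_negPlane_mem i₀ P⟩, ?_⟩
  rw [eq_mul_inv_iff_mul_eq]
  apply Subtype.ext
  change negAt i₀ * (X : Matrix (Fin (m + m)) (Fin (m + m)) ℝ) * negAt i₀ * (negAt i₀ * negPlane m P) =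
    negAt i₀ * negPlane m P * X
  calc negAt i₀ * (X : Matrix (Fin (m + m)) (Fin (m + m)) ℝ) * negAt i₀ * (negAt i₀ * negPlane m P)
      = negAt i₀ * X * (negAt i₀ * negAt i₀) * negPlane m P := by simp only [Matrix.mul_assoc]
    _ = negAt i₀ * (X * negPlane m P) := by rw [negAt_mul_negAt, Matrix.mul_one, Matrix.mul_assoc]
    _ = negAt i₀ * negPlane m P * X := by rw [← hcomm, Matrix.mul_assoc]

/-- Words commute with group homomorphisms: `w(f ∘ V) = f(w(V))` (Lévy's words `w(g)` «in r letters and their inverses»). [cite: Levy2004, Prop 3.4 (the words w(g))] -/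
theorem wordVal_comp_hom {G H : Type*} [Group G] [Group H] (f : G →* H) {ι : Type*} (w : List (ι × Bool))
    (V : ι → G) : wordVal w (f ∘ V) = f (wordVal w V) := by
  induction w with
  | nil => simp
  | cons a w ih =>
    rw [wordVal_cons, wordVal_cons, map_mul, ih]
    rcases a with ⟨i, _ | _⟩ <;> simp [letterVal]

/-- The value of a word `w(g)` lies in the subgroup generated by the letters `g_1, …, g_r`. [cite: Levy2004, Prop 3.4 (the words w(g))] -/
theorem wordVal_mem_closure {G : Type*} [Group G] {ι : Type*} (w : List (ι × Bool)) (V : ι → G) :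
    wordVal w V ∈ Subgroup.closure (Set.range V) := by
  induction w with
  | nil => rw [wordVal_nil]; exact one_mem _
  | cons a w ih =>
    rw [wordVal_cons]
    refine mul_mem ?_ ih
    rcases a with ⟨i, _ | _⟩
    · exact inv_mem (Subgroup.subset_closure ⟨i, rfl⟩)
    · exact Subgroup.subset_closure ⟨i, rfl⟩

/-- **EVERY WORD IS CONJUGATE**: `w(genW) = y · w(genV) · y⁻¹` in `SO(2m)` for every word `w` in two letters and their
inverses (`m ≥ 3`). [cite: Weidner2020, Prop 4.5; Levy2004, Prop 3.4 (hypothesis)] -/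
theorem exists_wordVal_conj (hm : 3 ≤ m) (i₀ : Fin (m + m)) (w : List (Fin 2 × Bool)) :
    ∃ y : SO2 m, wordVal w (genW m i₀) = y * wordVal w (genV m) * y⁻¹ := by
  rw [genW_eq, wordVal_comp_hom]
  exact exists_conj_of_mem_closure m hm i₀ (wordVal_mem_closure w _)

/-- **EVERY NON-EMPTY POSITIVE PRODUCT IS CONJUGATE** (the hypothesis of [Sengupta1994] Thm 2 / `ProdConjDetermined`), for
the families re-indexed along any `g : ι → Fin 2`. [cite: Sengupta1994, Thm 2 p.900; Weidner2020, Prop 4.5] -/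
theorem exists_prod_conj (hm : 3 ≤ m) (i₀ : Fin (m + m)) {ι : Type*} (g : ι → Fin 2) (l : List ι) :
    ∃ y : SO2 m, (l.map (genW m i₀ ∘ g)).prod = y * (l.map (genV m ∘ g)).prod * y⁻¹ := by
  have hW : (l.map (genW m i₀ ∘ g)).prod = reflConj m i₀ (l.map (genV m ∘ g)).prod := by
    rw [genW_eq, Function.comp_assoc, ← List.map_map, map_list_prod]
  rw [hW]
  refine exists_conj_of_mem_closure m hm i₀ (Subgroup.list_prod_mem _ fun x hx => ?_)
  obtain ⟨i, -, rfl⟩ := List.mem_map.1 hx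
  exact Subgroup.subset_closure ⟨g i, rfl⟩

end Generators

/-! ## §3 No simultaneous conjugator: `2J = D₁(1 − D₁²) + D₂(1 + D₁²)` and the sign of the Pfaffian -/

section NoConjugator

/-- **THE QUARTER TURN IS A POLYNOMIAL IN THE GENERATORS**: `u₁(1 − u₁²) + u₂(1 + u₁²) = 2i` plane by plane (the three
plane types `(i,1)`, `(i,i)`, `(1,i)` each give `2i`). [folklore] -/
private theorem uGen_poly : uGen m 0 * (1 - uGen m 0 ^ 2) + uGen m 1 * (1 + uGen m 0 ^ 2) = 2 • fun _ => Complex.I := by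
  funext k
  have hcases : (uGen m 0 k = Complex.I ∧ uGen m 1 k = 1) ∨ (uGen m 0 k = Complex.I ∧ uGen m 1 k = Complex.I) ∨
      (uGen m 0 k = 1 ∧ uGen m 1 k = Complex.I) := by
    rw [uGen_zero_apply, uGen_one_apply]
    by_cases h2 : (k : ℕ) = 2
    · have h0 : (k : ℕ) ≠ 0 := by omega
      rw [if_pos h2, if_neg h0]
      exact Or.inr (Or.inr ⟨rfl, rfl⟩)
    · by_cases h0 : (k : ℕ) = 0
      · rw [if_neg h2, if_pos h0]
        exact Or.inl ⟨rfl, rfl⟩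
      · rw [if_neg h2, if_neg h0]
        exact Or.inr (Or.inl ⟨rfl, rfl⟩)
  rw [Pi.add_apply, Pi.mul_apply, Pi.mul_apply, Pi.sub_apply, Pi.add_apply, Pi.one_apply, Pi.pow_apply,
    Pi.smul_apply, two_nsmul]
  rcases hcases with ⟨h0, h1⟩ | ⟨h0, h1⟩ | ⟨h0, h1⟩
  · rw [h0, h1]; linear_combination (1 - Complex.I) * Complex.I_sq
  · rw [h0, h1]; ring
  · rw [h0, h1]; ring

/-- Matrix form: `D₁(1 − D₁²) + D₂(1 + D₁²) = 2 J`, `J = realJ m`. [cite: AslaksenTanZhu1995, §1 Lemma 1 (proof) p.208] -/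
theorem genV_poly :
    Φ m (uGen m 0) * (1 - Φ m (uGen m 0) ^ 2) + Φ m (uGen m 1) * (1 + Φ m (uGen m 0) ^ 2) = (2 : ℝ) • realJ m := by
  have h := congrArg (Φ m) (uGen_poly m)
  rw [map_add, map_mul, map_mul, map_sub, map_add, map_pow, map_one, map_nsmul, Φ_I] at h
  rw [h, two_smul, two_smul]

variable {m}

/-- **CONJUGATION BY AN ORTHOGONAL MATRIX IS A RING HOMOMORPHISM** `X ↦ k X kᵀ`. [folklore] -/
def conjHom {n : Type*} [Fintype n] [DecidableEq n] (k : Matrix n n ℝ) (hk : kᵀ * k = 1) (hk' : k * kᵀ = 1) :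
    Matrix n n ℝ →+* Matrix n n ℝ where
  toFun X := k * X * kᵀ
  map_one' := by rw [Matrix.mul_one, hk']
  map_mul' X Y := by
    calc k * (X * Y) * kᵀ = k * X * (kᵀ * k) * Y * kᵀ := by rw [hk, Matrix.mul_one]; simp only [Matrix.mul_assoc]
      _ = k * X * kᵀ * (k * Y * kᵀ) := by simp only [Matrix.mul_assoc]
  map_zero' := by rw [Matrix.mul_zero, Matrix.zero_mul]
  map_add' X Y := by rw [Matrix.mul_add, Matrix.add_mul]

/-- Unfolding: `X ↦ k X kᵀ` (the congruence action under which `p̃f` transforms by `det k`). [cite: AslaksenTanZhu1995, §1 p.207 («pf(gAgᵗ) = det g pf A»)] -/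
@[simp] theorem conjHom_apply {n : Type*} [Fintype n] [DecidableEq n] (k : Matrix n n ℝ) (hk : kᵀ * k = 1)
    (hk' : k * kᵀ = 1) (X : Matrix n n ℝ) : conjHom k hk hk' X = k * X * kᵀ := rfl

/-- A ring homomorphism transports the polynomial identity: `f(D₁)(1 − f(D₁)²) + f(D₂)(1 + f(D₁)²) = 2 f(J)`. [folklore] -/
private theorem map_poly (f : Matrix (Fin (m + m)) (Fin (m + m)) ℝ →+* Matrix (Fin (m + m)) (Fin (m + m)) ℝ) :
    f (Φ m (uGen m 0)) * (1 - f (Φ m (uGen m 0)) ^ 2) + f (Φ m (uGen m 1)) * (1 + f (Φ m (uGen m 0)) ^ 2) =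
      (2 : ℝ) • f (realJ m) := by
  have h := congrArg f (genV_poly m)
  rw [map_add, map_mul, map_mul, map_sub, map_add, map_pow, map_one, two_smul, map_add] at h
  rw [h, two_smul]

variable (m)

/-- **NO ELEMENT OF `SO(2m)` CONJUGATES `genV` TO `genW` SIMULTANEOUSLY** (every `m`, every coordinate reflection `P_{i₀}`):
a conjugator `g` would satisfy `g J gᵀ = P_{i₀} J P_{i₀}` (`2J` is a polynomial in `D₁, D₂`), whence
`p̃f(J) = det g · p̃f(J) = det P_{i₀} · p̃f(J) = −p̃f(J)` by the Pfaffian of the skew part (p340120), but `p̃f(J) ≠ 0`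
(Weidner: `pl(ρ(1,0), ρ(0,1), …) ≠ 0` is odd under `X`; Larsen: the commutant has positive determinant).
[cite: Weidner2020, Prop 4.4 and Prop 4.5; AslaksenTanZhu1995, §1 p.207] -/
theorem not_exists_simultaneous_conj (i₀ : Fin (m + m)) : ¬ ∃ y : SO2 m, ∀ i, genW m i₀ i = y * genV m i * y⁻¹ := by
  rintro ⟨y, hy⟩
  set g : Matrix (Fin (m + m)) (Fin (m + m)) ℝ := (y : Matrix (Fin (m + m)) (Fin (m + m)) ℝ) with hg_def
  have hgO : g ∈ Matrix.orthogonalGroup (Fin (m + m)) ℝ := (Matrix.mem_specialOrthogonalGroup_iff.1 y.2).1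
  have hgdet : g.det = 1 := (Matrix.mem_specialOrthogonalGroup_iff.1 y.2).2
  have hg1 : gᵀ * g = 1 := by
    have h := Matrix.mem_unitaryGroup_iff'.1 hgO; rwa [star_eq_transpose'] at h
  have hg2 : g * gᵀ = 1 := by
    have h := Matrix.mem_unitaryGroup_iff.1 hgO; rwa [star_eq_transpose'] at h
  have hQ1 : (negAt i₀)ᵀ * negAt i₀ = 1 := by rw [← star_eq_transpose', star_negAt, negAt_mul_negAt]
  have hQ2 : negAt i₀ * (negAt i₀)ᵀ = 1 := by rw [← star_eq_transpose', star_negAt, negAt_mul_negAt]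
  -- the two generator identities, as matrices
  have hD : ∀ i, conjHom (negAt i₀) hQ1 hQ2 (Φ m (uGen m i)) = conjHom g hg1 hg2 (Φ m (uGen m i)) := fun i => by
    have h := congrArg (fun A : SO2 m => (A : Matrix (Fin (m + m)) (Fin (m + m)) ℝ)) (hy i)
    simp only [genW, coe_reflConj, coe_genV, Submonoid.coe_mul] at h
    rw [conjHom_apply, conjHom_apply, ← star_eq_transpose' (negAt i₀), star_negAt, h, ← Matrix.star_eq_inv,
      Matrix.specialUnitaryGroup.coe_star, star_eq_transpose', ← hg_def]
  -- hence `g J gᵀ = P J P`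
  have hJ2 : (2 : ℝ) • conjHom g hg1 hg2 (realJ m) = (2 : ℝ) • conjHom (negAt i₀) hQ1 hQ2 (realJ m) := by
    rw [← map_poly, ← map_poly, hD, hD]
  have hJ : g * realJ m * star g = negAt i₀ * realJ m * star (negAt i₀) := by
    have h := smul_right_injective (Matrix (Fin (m + m)) (Fin (m + m)) ℝ) (two_ne_zero' ℝ) hJ2
    simp only [conjHom_apply] at h
    rw [star_eq_transpose', star_eq_transpose', h]
  -- apply the Pfaffian of the skew part
  have hpf : pfaffian (g * realJ m * star g - (g * realJ m * star g)ᵀ) =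
      pfaffian (negAt i₀ * realJ m * star (negAt i₀) - (negAt i₀ * realJ m * star (negAt i₀))ᵀ) := by rw [hJ]
  rw [pfaffianSkew_conj, pfaffianSkew_conj, hgdet, det_negAt, one_mul] at hpf
  have hc := pfaffianSkew_realJ_ne_zero m
  apply hc
  linarith

end NoConjugator

/-! ## §4 Consequences: `ProdConjDetermined`, `TraceWordsSeparateOrbits` in every representation, Lévy's Prop. 3.4 -/

section Consequences

/-- **[Sengupta1994] THEOREM 2's CONCLUSION FAILS FOR `G = SO(2m)`, `m ≥ 3`**: `¬ ProdConjDetermined SO(2m)` (p334319's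
property), witnessed by Weidner's two-letter families (index type lifted to any universe).  Sengupta's printed list —
abelian, `U(n)`, `SU(n)`, `O(n)`, `SO(2n+1)` — rightly omits the even special orthogonal groups; by [Yu2021] Thm 1.1 the
omission is necessary exactly for `SO(2m)`, `m ≥ 3`. [cite: Sengupta1994, Thm 2 p.900; Weidner2020, Prop 4.5; Larsen1994, Thm 3.12] -/
theorem not_prodConjDetermined_specialOrthogonalGroup_add_self (hm : 3 ≤ m) :
    ¬ ProdConjDetermined.{0, v} (Matrix.specialOrthogonalGroup (Fin (m + m)) ℝ) := by
  intro hP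
  obtain ⟨i₀⟩ : Nonempty (Fin (m + m)) := ⟨⟨0, by omega⟩⟩
  obtain ⟨y, hy⟩ := (prodConjDetermined_iff _).1 hP (genV m ∘ ULift.down.{v}) (genW m i₀ ∘ ULift.down.{v})
    (fun l _ => exists_prod_conj m hm i₀ ULift.down l)
  exact not_exists_simultaneous_conj m i₀ ⟨y, fun i => hy ⟨i⟩⟩

/-- `SO(N)`, `N` even, `N ≥ 6`: `¬ ProdConjDetermined SO(N)`. [cite: Sengupta1994, Thm 2 p.900; Weidner2020, Prop 4.5; Larsen1994, Thm 3.12] -/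
theorem not_prodConjDetermined_specialOrthogonalGroup_even {N : ℕ} (hN : Even N) (h6 : 6 ≤ N) :
    ¬ ProdConjDetermined.{0, v} (Matrix.specialOrthogonalGroup (Fin N) ℝ) := by
  obtain ⟨m, rfl⟩ := hN
  exact not_prodConjDetermined_specialOrthogonalGroup_add_self m (by omega)

/-- **EQUAL WORD TRACES IN EVERY REPRESENTATION**: for every homomorphism `ρ : SO(2m) →* M_K(ℂ)` (any `K`; continuity not
needed), `Re/Im tr ρ(w(genV)) = Re/Im tr ρ(w(genW))` for every word `w` (`m ≥ 3`). [cite: Weidner2020, Prop 4.5 (element-conjugacy); Levy2004, Prop 3.4 (hypothesis)] -/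
theorem tracePart_wordVal_eq (hm : 3 ≤ m) (i₀ : Fin (m + m)) {K : ℕ} (ρ : SO2 m →* Matrix (Fin K) (Fin K) ℂ)
    (w : List (Fin 2 × Bool)) (b : Bool) : tracePart ρ b (wordVal w (genV m)) = tracePart ρ b (wordVal w (genW m i₀)) := by
  obtain ⟨y, hy⟩ := exists_wordVal_conj m hm i₀ w
  rw [hy, tracePart_conj]

/-- **`¬ TraceWordsSeparateOrbits ρ` FOR EVERY FINITE-DIMENSIONAL REPRESENTATION `ρ` OF `SO(2m)`, `m ≥ 3`** — module XXI's
orbit-separation schema fails in ALL representations at once, on the SAME explicit two-letter families (p340120 was the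
natural representation, p352070 all representations of `SO(8)`). [cite: Weidner2020, Prop 4.5; Larsen1994, Thm 3.12; Yu2021, Thm 1.1] -/
theorem not_traceWordsSeparateOrbits_of_three_le (hm : 3 ≤ m) {K : ℕ}
    (ρ : Matrix.specialOrthogonalGroup (Fin (m + m)) ℝ →* Matrix (Fin K) (Fin K) ℂ) : ¬ TraceWordsSeparateOrbits ρ := by
  intro hsep
  obtain ⟨i₀⟩ : Nonempty (Fin (m + m)) := ⟨⟨0, by omega⟩⟩
  obtain ⟨y, hy⟩ := hsep (Fin 2) (genV m) (genW m i₀) fun w b => tracePart_wordVal_eq m hm i₀ ρ w b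
  exact not_exists_simultaneous_conj m i₀ ⟨y, hy⟩

/-- **`SO(N)`, `N` EVEN, `N ≥ 6`, EVERY REPRESENTATION `ρ : SO(N) →* M_K(ℂ)`: `¬ TraceWordsSeparateOrbits ρ`.**
[cite: Weidner2020, Prop 4.5; Larsen1994, Thm 3.12; Yu2021, Thm 1.1] -/
theorem not_traceWordsSeparateOrbits_specialOrthogonalGroup_even_allRep {N : ℕ} (hN : Even N) (h6 : 6 ≤ N) {K : ℕ}
    (ρ : Matrix.specialOrthogonalGroup (Fin N) ℝ →* Matrix (Fin K) (Fin K) ℂ) : ¬ TraceWordsSeparateOrbits ρ := by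
  obtain ⟨m, rfl⟩ := hN
  exact not_traceWordsSeparateOrbits_of_three_le m (by omega) ρ

/-- In particular for the natural representation — the `N ≥ 6` cases of p340120's
`not_traceWordsSeparateOrbits_specialOrthogonalGroup_even`, by Weidner's witness instead of `(J, P J P)`. [cite: AslaksenTanZhu1995, Thm 3 p.209; Weidner2020, Prop 4.5] -/
theorem not_traceWordsSeparateOrbits_specialOrthogonalRep_even {N : ℕ} (hN : Even N) (h6 : 6 ≤ N) :
    ¬ TraceWordsSeparateOrbits (specialOrthogonalRep (Fin N)) :=
  not_traceWordsSeparateOrbits_specialOrthogonalGroup_even_allRep hN h6 _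

/-- **THE SHAPE OF [Levy2004] PROPOSITION 3.4 FAILS FOR `G = SO(2m)`, `m ≥ 3`, WITH TWO LETTERS**: there are
`g, g' ∈ SO(2m)²` such that `w(g)` and `w(g')` are conjugate in `SO(2m)` for EVERY word `w` in two letters and their inverses,
while `g, g'` are NOT in the same diagonal conjugacy class — so Wilson loops in all representations do not separate the gauge
orbits on the bouquet `L₂` ([Levy2004] Prop. 3.6: Thm 3.1 ⟺ Prop. 3.4), against the `SO(n)` clause of [Levy2004] Thm 3.1
for every even `n ≥ 6`; consistent with [Larsen1994] Thm 3.12 and [Yu2021] Thm 1.1. [cite: Levy2004, Prop 3.4 and Thm 3.1 (SO(n) clause); Weidner2020, Prop 4.5; Larsen1994, Thm 3.12] -/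
theorem exists_wordwise_conj_not_simultaneous_conj (hm : 3 ≤ m) :
    ∃ g g' : Fin 2 → Matrix.specialOrthogonalGroup (Fin (m + m)) ℝ,
      (∀ w : List (Fin 2 × Bool), IsConj (wordVal w g) (wordVal w g')) ∧
        ¬ ∃ k : Matrix.specialOrthogonalGroup (Fin (m + m)) ℝ, ∀ i, g' i = k * g i * k⁻¹ := by
  obtain ⟨i₀⟩ : Nonempty (Fin (m + m)) := ⟨⟨0, by omega⟩⟩
  refine ⟨genV m, genW m i₀, fun w => ?_, not_exists_simultaneous_conj m i₀⟩
  obtain ⟨y, hy⟩ := exists_wordVal_conj m hm i₀ w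
  exact isConj_iff.2 ⟨y, hy.symm⟩

/-- `SO(N)`, `N` even, `N ≥ 6`: the same with `r = 2` letters. [cite: Levy2004, Prop 3.4 and Thm 3.1 (SO(n) clause); Weidner2020, Prop 4.5] -/
theorem exists_wordwise_conj_not_simultaneous_conj_even {N : ℕ} (hN : Even N) (h6 : 6 ≤ N) :
    ∃ g g' : Fin 2 → Matrix.specialOrthogonalGroup (Fin N) ℝ,
      (∀ w : List (Fin 2 × Bool), IsConj (wordVal w g) (wordVal w g')) ∧
        ¬ ∃ k : Matrix.specialOrthogonalGroup (Fin N) ℝ, ∀ i, g' i = k * g i * k⁻¹ := by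
  obtain ⟨m, rfl⟩ := hN
  exact exists_wordwise_conj_not_simultaneous_conj m (by omega)

end Consequences

end Literature.MathematicalPhysics.QuantumFieldTheory.Balaban1983to89.WilsonLoopsNotCompleteEvenOrthogonal
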